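import Summits.QuantumFields.YangMills.Theorems.BalabanUVNodesPortS1JacobianHoloGauge

/-!
# NODE O port PT-A — THE `SL(2,ℂ)` STRUCTURE OF THE HOLOMORPHIC `b₀`-BLOCK: for `SL(2,ℂ)`-valued bond-matrix fields in the `1∕3`-polydisc the holomorphic (0.4) average is `SL(2,ℂ)`-valued
# (`det avgMh = 1`), the response in a traceless direction satisfies `tr( D_ℂ avgMh(W)[X·W(β)·δ_β](c) · (avgMh W c)⁻¹ ) = 0` (Jacobi's formula along the curve `W[β ↦ e^{tX}W(β)]`), and traceless
# matrices are recovered from their complex `su2Gen`-coordinates, which transform under conjugation by the complex adjoint matrices of `det_adMatC` — the algebra of row (d) of `stub_LZjac` in the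
# complex model

Cell `ym-nodeO-ideate`, porter seat `ymgap-nodeO-port-PTA-1` (gen 5); `--supports stmt-QuantumFields-27930` (helper; registered stub `stub_LZjac`, PORT-PLAN-v5 §4 rows (a)(d)).  [I] = [Balaban1987RG1],
[15] = [Balaban1985Variational].
CONSUMED BY NAME: `B15AveragingHolomorphic` (`avgMh`, `holMh`, `stepMh`, `loopMh`, `differentiableAt_avgMh`), `ExpMeanLog.det_eml_eq_one` (det-one families near `1`),
`Literature.Analysis.Matrix.det_exp_eq_exp_trace` (Liouville), ✓p812449 (`contDiff_holMh_two`), ✓p812392 (`su2CoordC`), ✓p810401 (`trace_su2Gen`), Mathlib's `Matrix.det_adjugate ∕ adjugate_mul ∕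
adjugate_fin_two ∕ det_fin_two ∕ trace_fin_two ∕ inv_eq_left_inv ∕ trace_mul_comm`.
* §1 `det_holMh_eq_one`, ★ `det_avgMh_eq_one`.
* §2 `hasDerivAt_det_two` (Jacobi, `2 × 2`), `trace_adjugate_mul_deriv_eq_zero`.
* §3 `det_update_exp_mul`, ★★ `trace_fderiv_avgMh_mul_inv_eq_zero`, ★ `trace_jacResponse_eq_zero` (the directions of `jacBlockC`).
* §4 `sum_su2CoordC_smul_su2Gen` (traceless matrices), `su2CoordC_add ∕ _smul ∕ _sum_smul`, ★ `su2CoordC_conj_eq_sum` (conjugation in complex coordinates).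

HONEST FRAMING.  Kernel calculus ∕ algebra over the tree's holomorphic model; NOTHING of Bałaban's estimates asserted, ported or discharged; the covariance of `avgMh` under `SL(2,ℂ)`-valued gauge
transformations and the full row (d) block law in the complex model remain (gen 6); `stub_LZjac` OPEN; `stub_LZdet` BLOCKED-ON P0 (α)+(β); `stub_FE` XXL; 27930 OPEN · no claim; K0⁷∕K-Ax OPEN;
NODE O 0∕1; COUNT 8∕28 · K 1∕4 UNMOVED; finite `𝕋⁴_{L^K}` at fixed ε — NOT continuum ∕ OS ∕ Clay; **the Yang–Mills mass gap is NOT proved by any of this.**  No `sorry`, no `def`, no `instance`,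
no `notation`; standard axioms.
-/

noncomputable section

open scoped BigOperators Matrix.Norms.L2Operator Topology

namespace Summit.QuantumFields.YangMills.Theorems.BalabanUVNodesPortS1

open Summit.QuantumFields.YangMills.Theorems.K0RecordFormatNames
open Literature.MathematicalPhysics.QuantumFieldTheory.Balaban1983to89
open Literature.MathematicalPhysics.QuantumFieldTheory.Balaban1983to89.Node00
open Literature.MathematicalPhysics.QuantumFieldTheory.Balaban1983to89.T4Continuum (T4Family LStep)
open Literature.MathematicalPhysics.QuantumFieldTheory.Balaban1983to89.BlockAveraging (Idx)
open Literature.MathematicalPhysics.QuantumFieldTheory.Balaban1983to89.BlockAveragingHaarAC (centralBond)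
open Literature.MathematicalPhysics.QuantumFieldTheory.Balaban1983to89.ExpMeanLog (eml eml_eq_exp analyticAt_eml)
open Literature.MathematicalPhysics.QuantumFieldTheory.Balaban1983to89.B15AveragingHolomorphic
open _root_.Matrix _root_.Filter

variable {P : Params} {j : ℕ}

/-! ## §1  Determinant one propagates through the holomorphic model -/

/-- Walk products of `det = 1` bond matrices have `det = 1` (`det adj A = det A` for `2 × 2`). [cite: Balaban1987RG1, (1.10) p.262 («Gᶜ-valued»; bookkeeping)] -/
theorem det_holMh_eq_one (V : PBond P j → MatA 2) (hV : ∀ b, (V b).det = 1) : ∀ γ : List (LStep P j), (holMh V γ).det = 1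
  | [] => by rw [holMh_nil, Matrix.det_one]
  | s :: γ => by
    rw [holMh_cons, Matrix.det_mul, det_holMh_eq_one V hV γ, mul_one]
    unfold stepMh
    split_ifs
    · exact hV _
    · rw [Matrix.det_adjugate, hV, one_pow]

/-- ★ **THE HOLOMORPHIC AVERAGE OF AN `SL(2,ℂ)`-VALUED FIELD IN THE `1∕3`-POLYDISC IS `SL(2,ℂ)`-VALUED**: `det (avgMh V c) = 1` (`det eml = 1` on det-one families near `1`, the tree's `det_eml_eq_one`;
walk products). [cite: Balaban1987RG1, before (0.5) p.253 («Gᶜ-valued function»), (0.4) p.253] -/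
theorem det_avgMh_eq_one (V : PBond P j → MatA 2) (hV : ∀ b, (V b).det = 1) (c : PBond P (j + 1))
    (h : ∀ i : Idx P, ‖loopMh V c i - 1‖ < 1 / 3) : (avgMh V c).det = 1 := by
  have hax : (axialMh V c).det = 1 := det_holMh_eq_one V hV _
  show (eml (fun i : Idx P => loopMh V c i) * axialMh V c).det = 1
  rw [Matrix.det_mul, hax, mul_one]
  refine ExpMeanLog.det_eml_eq_one (fun i => det_holMh_eq_one V hV _) (fun i => (h i).le) fun i => ?_
  rw [Fintype.card_fin]
  have := Real.pi_gt_three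
  have hi := h i
  push_cast
  nlinarith

/-! ## §2  Jacobi's formula for `2 × 2` matrices and the tracelessness of the response in `SL(2,ℂ)` directions -/

/-- **Jacobi's formula, `2 × 2`**: along a differentiable matrix curve, `d∕dt det A(t) = tr(adj A(t) · A′(t))`. [folklore] -/
theorem hasDerivAt_det_two {A : ℝ → MatA 2} {A' : MatA 2} {t : ℝ} (hA : HasDerivAt A A' t) :
    HasDerivAt (fun s => (A s).det) (Matrix.trace ((A t).adjugate * A')) t := by
  have he : ∀ a b : Fin 2, HasDerivAt (fun s => A s a b) (A' a b) t := fun a b =>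
    ((LinearMap.toContinuousLinearMap (Matrix.entryLinearMap ℂ ℂ a b)).hasFDerivAt.restrictScalars ℝ).comp_hasDerivAt t hA
  have hfun : (fun s => (A s).det) = fun s => A s 0 0 * A s 1 1 - A s 0 1 * A s 1 0 := funext fun s => Matrix.det_fin_two _
  rw [hfun]
  have h := ((he 0 0).mul (he 1 1)).sub ((he 0 1).mul (he 1 0))
  have htr : Matrix.trace ((A t).adjugate * A') = A' 0 0 * A t 1 1 + A t 0 0 * A' 1 1 - (A' 0 1 * A t 1 0 + A t 0 1 * A' 1 0) := by
    rw [Matrix.trace_fin_two, Matrix.mul_apply, Matrix.mul_apply]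
    simp only [Fin.sum_univ_two]
    rw [Matrix.adjugate_fin_two]
    simp only [Matrix.of_apply, Matrix.cons_val', Matrix.cons_val_zero, Matrix.cons_val_one, Matrix.empty_val', Matrix.cons_val_fin_one]
    ring
  rw [htr]
  exact h

/-- **A curve of determinant-one matrices has `tr(A⁻¹A′) = 0`** (`2 × 2`: `adj A = A⁻¹`). [folklore] -/
theorem trace_adjugate_mul_deriv_eq_zero {A : ℝ → MatA 2} {A' : MatA 2} {t : ℝ} (hA : HasDerivAt A A' t) (hdet : ∀ᶠ s in 𝓝 t, (A s).det = 1) :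
    Matrix.trace ((A t).adjugate * A') = 0 := by
  have h : HasDerivAt (fun _ : ℝ => (1 : ℂ)) (Matrix.trace ((A t).adjugate * A')) t :=
    HasDerivAt.congr_of_eventuallyEq (hasDerivAt_det_two hA) (hdet.mono fun s hs => hs.symm)
  exact h.unique (hasDerivAt_const t (1 : ℂ))

/-! ## §3  ★★ The holomorphic response of an `SL(2,ℂ)`-valued field in a traceless direction is traceless against `(avgMh W c)⁻¹` -/

/-- A single-bond exponential curve of an `SL(2,ℂ)`-valued field stays `SL(2,ℂ)`-valued (`det e^{tX} = e^{t·tr X} = 1`). [cite: Balaban1987RG1, (1.10) p.262 («Gᶜ-valued»; bookkeeping)] -/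
theorem det_update_exp_mul (W : PBond P j → MatA 2) (hW : ∀ b, (W b).det = 1) (β : PBond P j) {X : MatA 2} (hX : X.trace = 0) (t : ℝ) (b : PBond P j) :
    ((fun b' : PBond P j => if b' = β then NormedSpace.exp (t • X) * W β else W b') b).det = 1 := by
  letI : NormedAlgebra ℚ (MatA 2) := NormedAlgebra.restrictScalars ℚ ℂ (MatA 2)
  by_cases hb : b = β
  · simp only [hb, if_true, Matrix.det_mul, hW, mul_one]
    rw [Literature.Analysis.Matrix.det_exp_eq_exp_trace, Matrix.trace_smul, hX, smul_zero, NormedSpace.exp_zero]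
  · simp only [hb, if_false, hW]

/-- ★★ **TRACELESSNESS OF THE RESPONSE**: for an `SL(2,ℂ)`-valued field `W` whose (0.4) loop matrices lie in the `1∕3`-polydisc at every coarse bond, and a traceless `X`,
`tr( D_ℂ avgMh(W)[X·W(β)·δ_β](c) · (avgMh W c)⁻¹ ) = 0` — the holomorphic average stays `SL(2,ℂ)`-valued along the curve `t ↦ W[β ↦ e^{tX}W(β)]` (`det_avgMh_eq_one`), Jacobi's formula at `t = 0`,
and `adj = ⁻¹` at determinant one.  (So the holomorphic block `A₁^ℂ(c)` reads an 𝔰𝔩(2,ℂ)-valued response — the complex coordinates `su2CoordC` lose nothing.)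
[cite: Balaban1987RG1, (0.4) p.253, (1.10) p.262, p.267; Balaban1985Variational, Prop. 9 p.309] -/
theorem trace_fderiv_avgMh_mul_inv_eq_zero (W : PBond P j → MatA 2) (hW : ∀ b, (W b).det = 1)
    (hpoly : ∀ (c : PBond P (j + 1)) (i : Idx P), ‖loopMh W c i - 1‖ < 1 / 3) (c : PBond P (j + 1)) (β : PBond P j) {X : MatA 2} (hX : X.trace = 0) :
    Matrix.trace (fderiv ℂ (avgMh : (PBond P j → MatA 2) → PBond P (j + 1) → MatA 2) W (Pi.single β (X * W β)) c * (avgMh W c)⁻¹) = 0 := by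
  classical
  letI : NormedAlgebra ℚ (MatA 2) := NormedAlgebra.restrictScalars ℚ ℂ (MatA 2)
  -- the curve and its velocity
  set γ : ℝ → PBond P j → MatA 2 := fun t b' => if b' = β then NormedSpace.exp (t • X) * W β else W b' with hγ
  have hγ0 : γ 0 = W := by
    funext b'
    simp only [hγ, zero_smul, NormedSpace.exp_zero, one_mul]
    split_ifs with h
    · rw [h]
    · rfl
  have hγd : HasDerivAt γ (Pi.single β (X * W β)) 0 := by
    refine hasDerivAt_pi.2 fun b' => ?_
    by_cases hb : b' = β
    · subst hb
      simp only [hγ, if_true, Pi.single_eq_same]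
      have hline : HasDerivAt (fun t : ℝ => t • X) X 0 := by simpa using (hasDerivAt_id (0 : ℝ)).smul_const X
      have hexp : HasFDerivAt (NormedSpace.exp : MatA 2 → MatA 2) ((1 : MatA 2 →L[ℂ] MatA 2).restrictScalars ℝ) ((fun t : ℝ => t • X) 0) := by
        have e : (fun t : ℝ => t • X) 0 = 0 := zero_smul _ _
        rw [e]; exact (hasFDerivAt_exp_zero (𝕂 := ℂ)).restrictScalars ℝ
      have h := (hexp.comp_hasDerivAt (0 : ℝ) hline).mul_const (W b')
      exact h
    · simp only [hγ, hb, if_false, Pi.single_eq_of_ne hb]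
      exact hasDerivAt_const _ _
  -- the average along the curve
  have hpoly1 : ∀ (c' : PBond P (j + 1)) (i : Idx P), ‖loopMh W c' i - 1‖ < 1 := fun c' i => (hpoly c' i).trans (by norm_num)
  have hM : HasFDerivAt (avgMh : (PBond P j → MatA 2) → PBond P (j + 1) → MatA 2)
      ((fderiv ℂ (avgMh : (PBond P j → MatA 2) → PBond P (j + 1) → MatA 2) W).restrictScalars ℝ) (γ 0) := by
    rw [hγ0]; exact (differentiableAt_avgMh hpoly1).hasFDerivAt.restrictScalars ℝ
  have hA : HasDerivAt (fun t : ℝ => avgMh (γ t) c)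
      (fderiv ℂ (avgMh : (PBond P j → MatA 2) → PBond P (j + 1) → MatA 2) W (Pi.single β (X * W β)) c) 0 :=
    (hasDerivAt_pi.mp (hM.comp_hasDerivAt (0 : ℝ) hγd)) c
  -- the determinant is `1` along the curve near `0`
  have hcontγ : Continuous γ := by
    refine continuous_pi fun b' => ?_
    by_cases hb : b' = β
    · simp only [hγ, hb, if_true]
      exact (NormedSpace.exp_continuous.comp (continuous_id.smul continuous_const)).mul continuous_const
    · simp only [hγ, hb, if_false]; exact continuous_const
  have hev : ∀ᶠ t : ℝ in 𝓝 0, ∀ (c' : PBond P (j + 1)) (i : Idx P), ‖loopMh (γ t) c' i - 1‖ < 1 / 3 := by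
    refine Filter.eventually_all.2 fun c' => Filter.eventually_all.2 fun i => ?_
    have hc : Continuous fun t : ℝ => ‖loopMh (γ t) c' i - 1‖ := (((contDiff_holMh_two _).continuous.comp hcontγ).sub continuous_const).norm
    have h0 : ‖loopMh (γ 0) c' i - 1‖ < 1 / 3 := by rw [hγ0]; exact hpoly c' i
    exact hc.continuousAt.eventually_lt continuousAt_const h0
  have hdet : ∀ᶠ t : ℝ in 𝓝 0, (avgMh (γ t) c).det = 1 :=
    hev.mono fun t ht => det_avgMh_eq_one (γ t) (fun b' => det_update_exp_mul W hW β hX t b') c (ht c)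
  -- Jacobi at `t = 0`
  have hJ := trace_adjugate_mul_deriv_eq_zero hA hdet
  rw [hγ0] at hJ
  have hinv : (avgMh W c)⁻¹ = (avgMh W c).adjugate := by
    refine Matrix.inv_eq_left_inv ?_
    rw [Matrix.adjugate_mul, det_avgMh_eq_one W hW c (hpoly c), one_smul]
  rw [hinv, Matrix.trace_mul_comm]
  exact hJ

/-- ★ **… in particular for the directions of the holomorphic block**: `tr( D_ℂ avgMh(W)[su2Gen a·W(b₀(c))·δ](c) · (avgMh W c)⁻¹ ) = 0`. [cite: Balaban1987RG1, p.267 («h(c) is a linear operator on the Lie algebra»)] -/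
theorem trace_jacResponse_eq_zero (W : PBond P j → MatA 2) (hW : ∀ b, (W b).det = 1)
    (hpoly : ∀ (c : PBond P (j + 1)) (i : Idx P), ‖loopMh W c i - 1‖ < 1 / 3) (c : PBond P (j + 1)) (a : Fin 3) :
    Matrix.trace (fderiv ℂ (avgMh : (PBond P j → MatA 2) → PBond P (j + 1) → MatA 2) W
      (Pi.single (centralBond c) (su2Gen a * W (centralBond c))) c * (avgMh W c)⁻¹) = 0 :=
  trace_fderiv_avgMh_mul_inv_eq_zero W hW hpoly c (centralBond c) (trace_su2Gen a)

/-! ## §4  Complex coordinates of traceless matrices and conjugation in coordinates (the block law's algebra, complex edition) -/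

/-- **A traceless `2 × 2` matrix is the complex combination of `su2Gen` with its `su2CoordC` coefficients.** [folklore] -/
theorem sum_su2CoordC_smul_su2Gen {M : MatA 2} (hM : M.trace = 0) : ∑ a, su2CoordC M a • su2Gen a = M := by
  have h11 : M 1 1 = -M 0 0 := by
    rw [Matrix.trace_fin_two] at hM
    linear_combination hM
  ext i k
  fin_cases i <;> fin_cases k <;> simp [su2CoordC, su2Gen, Fin.sum_univ_three, Matrix.add_apply, h11] <;> ring_nf <;>
    simp [Complex.I_sq] <;> ring

/-- `su2CoordC_i` is additive. [folklore] -/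
theorem su2CoordC_add (M N : MatA 2) (i : Fin 3) : su2CoordC (M + N) i = su2CoordC M i + su2CoordC N i := by
  fin_cases i <;> simp [su2CoordC] <;> ring

/-- `su2CoordC_i` is ℂ-homogeneous. [folklore] -/
theorem su2CoordC_smul (z : ℂ) (M : MatA 2) (i : Fin 3) : su2CoordC (z • M) i = z * su2CoordC M i := by
  fin_cases i <;> simp [su2CoordC] <;> ring

/-- `su2CoordC_i` is ℂ-linear: coordinates of a complex combination. [folklore] -/
theorem su2CoordC_sum_smul (N : Fin 3 → MatA 2) (z : Fin 3 → ℂ) (i : Fin 3) :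
    su2CoordC (∑ a, z a • N a) i = ∑ a, z a * su2CoordC (N a) i := by
  simp only [Fin.sum_univ_three, su2CoordC_add, su2CoordC_smul]

/-- **Conjugation in complex coordinates** (any `g`, traceless `M`): `su2CoordC(g·M·adj g)_i = Σ_{j} su2CoordC(g·su2Gen j·adj g)_i · su2CoordC(M)_j` — the holomorphic `b₀`-blocks transform by the
complex adjoint matrices `Ad^ℂ(g)` of `det_adMatC`. [cite: Balaban1987RG1, (1.10) p.262, (1.19) p.263] -/
theorem su2CoordC_conj_eq_sum (g : MatA 2) {M : MatA 2} (hM : M.trace = 0) (i : Fin 3) :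
    su2CoordC (g * M * g.adjugate) i = ∑ j', su2CoordC (g * su2Gen j' * g.adjugate) i * su2CoordC M j' := by
  have hM' : M = ∑ a, su2CoordC M a • su2Gen a := (sum_su2CoordC_smul_su2Gen hM).symm
  have hconj : g * M * g.adjugate = ∑ a, su2CoordC M a • (g * su2Gen a * g.adjugate) := by
    conv_lhs => rw [hM']
    simp only [Matrix.mul_sum, Matrix.sum_mul, Matrix.mul_smul, Matrix.smul_mul]
  rw [hconj, su2CoordC_sum_smul]
  exact Finset.sum_congr rfl fun a _ => mul_comm _ _

end Summit.QuantumFields.YangMills.Theorems.BalabanUVNodesPortS1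

end
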